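import Summits.ResolutionOfSingularities.ResolutionOfSingularities.Theorems.ForcedTowerClasses
import Summits.ResolutionOfSingularities.ResolutionOfSingularities.Theorems.WeakOrderReduction
import HarnessLib

/-!
# DivergentTowerClasses — proximity, divergence and Shannon germ-hugging on forced point towers
(decomp-res node N45 «DivergentTowers», lens-4 g8 = rev 2 of ForcedTowers; route-independent part, phase 1)

Source HOME/decomp-res-lens-4/g8/DivergentTowers.lean (sha256 8ba89e0503aedfc1, 745 lines), CRITIC-LEDGER row 52
(2026-08-30T07:48Z): CLEARED AS ATTACK NODE rev 2 WITH TWO DECIDED-MOD-PORT LEAVES.  Built over the LANDED g7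
vocabulary `Theorems/ForcedTowerClasses` (`ForcedTower`, `WOR n ⟺ SeqDimFour 1 n`, König normal form
`wor_of_forced`, ports `ForcedSeed`/`ForcedDescent`/`TowerObstructs`); the g8 tower predicates are stated with the
tower as an EXPLICIT argument (`SatelliteStep T i`, …) and the E₀-fixed eventual freeness is `EventuallyFreeOwn T`
(satellites measured against the tower's OWN exceptional components `comps T i`, the junk initial boundary dropped —
the critic's row-47 sharpening; g7's `ForcedTower.EventuallyFree` used `boundary.dropLast`).

THE g8 MOVES.  (M1) DIVERGENCE — NEW LEMMA, port `TowerDivergence n` (perfect ground fields; paper proof in the lens: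
Giraud's characteristic-free inclusion `x_i⁻¹·Diff^{≤n-1}(I_i) ⊆ Diff^{≤n-1}(I_{i+1})` + telescoping + `𝔪^N ⊆
Diff^{≤n-1}(I_0)` by isolation): along an infinite forced tower `ord_{R_i}(g) → ∞`, so the tower is `Divergent`.
(M2) PROXIMITY LAW — port `ProximityLaw n` (Casas-Alvero Thm 3.5.3; Kiyek–Vicente VII (7.1)): `c_{i+1} = c_i +
Σ_{older proximate j} c_j`, so divergence forces infinitely many SATELLITE steps; hence EVERY EVENTUALLY-FREE forced
tower over a perfect ground field is finite (`eventuallyFree_perfect_of_ports`, PROVED from the two ports).  (M3)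
SHANNON DICHOTOMY on satellite-recurrent towers (EXACT by excluded middle, `srtt_iff_leaves`): τ≥2-exceptional
hugging (port `ConeLineLaw`, DECIDED-MOD-PORT | perfect k) · germ hugging (UNDECIDED, attackable via the dim ≤ 3
shadow) · valuative (rank-one valuation towers — THE located residual).  (M4) E2-ABSORPTION (port
`ClassTwoTailsDie`): under `SeqDimFour 2 n` only CORE towers matter, giving the core leaves
`CoreGermHuggingTowersTerminate` / `CoreValuativeTowersTerminate` that refine `MaxContactCut.RungOne` (29273) —
links BY NAME in `Theorems/MaxContactCutDivergentTowers.lean` (phase 3). Sources: CasasAlvero2000 Thm 3.5.3, §3.6;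
KiyekVicente2004 VII (7.1), VIII (6.12); Shannon1973; HLOST2016 (arXiv:1505.06445);
HeinzerOlberdingToeniskoetter2017 (arXiv:1509.07545) 4.2 / 5.3; BravoVillamayor2012 §§3–5; CossartJannsenSaito2020
Ch. 2–3; Kollar2007 3.75–3.76; HIO1988 §§20–23. 0 sorry. -/

open CategoryTheory AlgebraicGeometry
open Literature.AlgebraicGeometry.Resolution
open Summit.ResolutionOfSingularities.ResolutionOfSingularities.Theorems.WeakOrderReduction
open Summit.ResolutionOfSingularities.ResolutionOfSingularities.Theorems.ForcedTowerClasses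

namespace Summit.ResolutionOfSingularities.ResolutionOfSingularities.Theorems.DivergentTowerClasses

/-! ## §1 Proximity bookkeeping, divergence, germ hugging — predicates on a forced tower

BGMW order of the boundary (`MarkedIdeal.transform`): `(D (i+1)).boundary = (D i).boundary.map (strict transform) ++
[(centre i).comap (π i)]`.  Dropping the first `|(D 0).boundary|` entries (strict transforms of the arbitrary
initial boundary `E₀` — the critic's sharpening) leaves the tower's OWN components `comps T i = [E_0^{(i)}, …,
E_{i-1}^{(i)}]`, the `j`-th entry being the strict transform at stage `i` of the exceptional divisor `E_j` of the
blow-up at `pt j`. -/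


/-- The tower's own exceptional components at stage `i` (the junk initial boundary dropped). -/
def comps (T : ForcedTower) (i : ℕ) : List (T.St i).IdealSheafData :=
  (T.D i).boundary.drop (T.D 0).boundary.length

/-- `pt i` is PROXIMATE to `pt j` (`j < i`): `pt i` lies on the strict transform `E_j^{(i)}` of the exceptional
divisor of the blow-up at `pt j`. -/
def Proximate (T : ForcedTower) (i j : ℕ) : Prop :=
  j < i ∧ ∃ B ∈ (comps T i)[j]?, T.pt i ∈ (B.support : Set (T.St i))

/-- Step `i` is a SATELLITE step: `pt (i+1)` is proximate to an OLDER point `pt j`, `j < i` (it is always proximate to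
`pt i`).  Otherwise the step is FREE. -/
def SatelliteStep (T : ForcedTower) (i : ℕ) : Prop :=
  ∃ j, j < i ∧ Proximate T (i + 1) j

/-- Infinitely many satellite steps. -/
def SatelliteRecurrent (T : ForcedTower) : Prop :=
  ∀ i₀ : ℕ, ∃ i, i₀ ≤ i ∧ SatelliteStep T i

/-- From some stage on every step is free. -/
def EventuallyFreeOwn (T : ForcedTower) : Prop :=
  ∃ i₀ : ℕ, ∀ i, i₀ ≤ i → ¬ SatelliteStep T i

/-- The tower HUGS its component `E_j` forever (every later point is proximate to `pt j`). -/
def Hugs (T : ForcedTower) (j : ℕ) : Prop :=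
  ∀ i, j < i → Proximate T i j

/-- TOTAL transform of the first centre on stage `i+1`: the ideal `𝔪_{pt 0}·𝒪_{St (i+1)} = (x₀)`, the equation of
`E_0^* = Σ_j c_j E_j` (`c_j = ord_{R_j} x₀`). -/
noncomputable def tot (T : ForcedTower) : (i : ℕ) → (T.St (i + 1)).IdealSheafData
  | 0 => (T.centre 0).comap (T.π 0)
  | i + 1 => (tot T i).comap (T.π (i + 1))

/-- DIVERGENT: `c_{i+1} = ord_{pt (i+1)}(x₀)` is unbounded (the port `TowerDivergence` says every infinite forced
tower of the class is divergent — NEW LEMMA (M1)). -/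
def Divergent (T : ForcedTower) : Prop :=
  ∀ N : ℕ, ∃ i, ((N : ℕ) : ℕ∞) ≤ idealOrder (tot T i) (T.pt (i + 1))

/-- Iterated STRICT transform along the tower of a germ ideal `H` on stage `m`. -/
noncomputable def strictIter (T : ForcedTower) (m : ℕ) (H : (T.St m).IdealSheafData) :
    (j : ℕ) → (T.St (m + j)).IdealSheafData
  | 0 => H
  | j + 1 => strictTransformIdeal (T.π (m + j)) (T.centre (m + j)) (strictIter T m H j)

/-- The tower HUGS THE GERM `V(H) ∋ pt m` forever: `H` is non-zero at `pt m` (finite order there) and every later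
point lies on the iterated strict transform (`j = 0`: `pt m ∈ V(H)`). -/
def HugsGerm (T : ForcedTower) (m : ℕ) (H : (T.St m).IdealSheafData) : Prop :=
  idealOrder H (T.pt m) ≠ ⊤ ∧ ∀ j, T.pt (m + j) ∈ ((strictIter T m H j).support : Set (T.St (m + j)))

/-- GERM-HUGGING: some proper germ through some `pt m` (a hypersurface of «permanent contact», a curve, the
directrix plane …) is hugged forever.  Port-level reading (Shannon 1973; HLOST 2016 Remark 5.3; HOT 2017 Discussion
4.2): `¬ GermHugging` iff `⋃ 𝒪_{St i, pt i}` is a rank-one valuation ring, i.e. the tower is the sequence of centres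
of a real-rank-one valuation. -/
def GermHugging (T : ForcedTower) : Prop :=
  ∃ (m : ℕ) (H : (T.St m).IdealSheafData), HugsGerm T m H

/-- τ≥2-EXCEPTIONAL HUGGING: the tower hugs one of its own components `E_j` forever and Hironaka's `τ(pt j) ≥ 2`
(for some — equivalently any — regularity witness of `St j`). -/
def TauTwoHugging (T : ForcedTower) (n : ℕ) : Prop :=
  ∃ j, Hugs T j ∧ ∃ hR : Scheme.IsRegular (T.St j), 2 ≤ tauAt hR (T.D j).ideal n (T.pt j)

/-- Some stage of the tower is a point of lens-2 CLASS ≥ 2 (contact, or contact-free with `τ ≥ 2`) for some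
`k`-structure of the class on that stage. -/
def ClassTwoSomewhere (T : ForcedTower) (n : ℕ) (k : Type) [Field k] : Prop :=
  ∃ (i : ℕ) (g' : T.St i ⟶ Spec (.of k)) (hB : IsBase (T.St i) g'), ClassGE g' hB.isRegular (T.D i).ideal n 2 (T.pt i)


/-- pure logic. [folklore] -/
theorem satelliteRecurrent_iff_not_eventuallyFree {T : ForcedTower} :
    SatelliteRecurrent T ↔ ¬ EventuallyFreeOwn T := by
  simp only [SatelliteRecurrent, EventuallyFreeOwn, not_exists, not_forall, not_not, exists_prop]

/-- pure logic. [folklore] -/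
theorem eventuallyFree_of_not_satelliteRecurrent {T : ForcedTower} (h : ¬ SatelliteRecurrent T) :
    EventuallyFreeOwn T := by
  by_contra h'
  exact h (satelliteRecurrent_iff_not_eventuallyFree.mpr h')

/-- Hugging a component forever makes every later step a satellite step. [folklore] -/
theorem satelliteRecurrent_of_hugs {T : ForcedTower} {j : ℕ} (h : Hugs T j) : SatelliteRecurrent T := by
  intro i₀
  refine ⟨max i₀ (j + 1), le_max_left _ _, j, ?_, h _ ?_⟩
  · exact Nat.lt_of_lt_of_le (Nat.lt_succ_self j) (le_max_right _ _)
  · exact Nat.lt_of_lt_of_le (Nat.lt_succ_self j) ((le_max_right _ _).trans (Nat.le_succ _))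

/-- pure logic. [folklore] -/
theorem satelliteRecurrent_of_tauTwoHugging {T : ForcedTower} {n : ℕ} (h : TauTwoHugging T n) :
    SatelliteRecurrent T := by
  obtain ⟨j, hj, -⟩ := h
  exact satelliteRecurrent_of_hugs hj


/-! ## §2 The pieces cut by the proximity / Shannon structure -/

/-- «No infinite forced tower of the class (marking `n`, dimension ≤ 4) satisfies `P`.» -/
def NoTower (n : ℕ) (P : ForcedTower → Prop) : Prop :=
  ∀ p : ℕ, p.Prime → ∀ (k : Type) [Field k] [CharP k p] (T : ForcedTower) (g : T.St 0 ⟶ Spec (.of k)),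
    IsBase (T.St 0) g → IsDatum n (T.D 0) → (T.D 0).boundary = [] → P T → False

/-- pure logic. [folklore] -/
theorem forcedTowersTerminate_iff_noTower {n : ℕ} : ForcedTowersTerminate n ↔ NoTower n fun _ => True :=
  ⟨fun h p hp k _ _ T g hB hD hE _ => h p hp k T g hB hD hE,
    fun h p hp k _ _ T g hB hD hE => h p hp k T g hB hD hE trivial⟩

/-- pure logic. [folklore] -/
theorem noTower_mono {n : ℕ} {P Q : ForcedTower → Prop} (hPQ : ∀ T, Q T → P T) (h : NoTower n P) : NoTower n Q :=
  fun p hp k _ _ T g hB hD hE hQ => h p hp k T g hB hD hE (hPQ T hQ)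

/-- EXACT bisection of any tower class by any predicate (excluded middle). [folklore] -/
theorem noTower_split {n : ℕ} (P Q : ForcedTower → Prop) :
    NoTower n P ↔ NoTower n (fun T => P T ∧ Q T) ∧ NoTower n (fun T => P T ∧ ¬ Q T) := by
  refine ⟨fun h => ⟨noTower_mono (fun _ h' => h'.1) h, noTower_mono (fun _ h' => h'.1) h⟩, ?_⟩
  rintro ⟨h₁, h₂⟩ p hp k _ _ T g hB hD hE hP
  by_cases hQ : Q T
  · exact h₁ p hp k T g hB hD hE ⟨hP, hQ⟩
  · exact h₂ p hp k T g hB hD hE ⟨hP, hQ⟩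

/-- PIECE · DECIDED-MOD-PORT ((M1)+(M2)): no infinite EVENTUALLY-FREE forced tower. -/
def EventuallyFreeTowersTerminate (n : ℕ) : Prop := NoTower n EventuallyFreeOwn

/-- PIECE (the tower-side residual of g7 after (M1)+(M2)): no infinite SATELLITE-RECURRENT forced tower. -/
def SatelliteRecurrentTowersTerminate (n : ℕ) : Prop := NoTower n SatelliteRecurrent

/-- LEAF · DECIDED-MOD-PORT | perfect `k` (`ConeLineLaw`): no infinite tower hugging a `τ ≥ 2` component forever. -/
def TauTwoHuggingTowersTerminate (n : ℕ) : Prop := NoTower n fun T => TauTwoHugging T n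

/-- LEAF · UNDECIDED(test T-forced-3) · ATTACKABLE (dim ≤ 3 shadow): no infinite satellite-recurrent tower which is
not τ≥2-exceptional-hugging but hugs SOME proper germ forever. -/
def GermHuggingTowersTerminate (n : ℕ) : Prop :=
  NoTower n fun T => SatelliteRecurrent T ∧ ¬ TauTwoHugging T n ∧ GermHugging T

/-- LEAF · IDEA-NEEDED (the located p-core of the tower side): no infinite VALUATIVE tower — satellite-recurrent, no
proper germ hugged (Shannon: `⋃ R_i` is a rank-one valuation ring; the tower is the centre sequence of a
real-rank-one valuation). -/
def ValuativeTowersTerminate (n : ℕ) : Prop :=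
  NoTower n fun T => SatelliteRecurrent T ∧ ¬ TauTwoHugging T n ∧ ¬ GermHugging T

/-- Kernel (PROVED, excluded middle): the tower piece splits EXACTLY into eventually-free and satellite-recurrent
towers. [folklore] -/
theorem ftt_iff_free_satellite {n : ℕ} :
    ForcedTowersTerminate n ↔ EventuallyFreeTowersTerminate n ∧ SatelliteRecurrentTowersTerminate n := by
  rw [forcedTowersTerminate_iff_noTower, noTower_split (fun _ => True) EventuallyFreeOwn]
  refine and_congr ⟨noTower_mono fun _ h => ⟨trivial, h⟩, noTower_mono fun _ h => h.2⟩
    ⟨noTower_mono fun _ h => ⟨trivial, ?_⟩, noTower_mono fun _ h => ?_⟩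
  · exact satelliteRecurrent_iff_not_eventuallyFree.mp h
  · exact satelliteRecurrent_iff_not_eventuallyFree.mpr h.2

/-- Kernel (PROVED, excluded middle twice): the satellite-recurrent piece splits EXACTLY into the three leaves of
(M3). [folklore] -/
theorem srtt_iff_leaves {n : ℕ} :
    SatelliteRecurrentTowersTerminate n ↔
      NoTower n (fun T => SatelliteRecurrent T ∧ TauTwoHugging T n) ∧
        GermHuggingTowersTerminate n ∧ ValuativeTowersTerminate n := by
  unfold SatelliteRecurrentTowersTerminate GermHuggingTowersTerminate ValuativeTowersTerminate
  rw [noTower_split SatelliteRecurrent (fun T => TauTwoHugging T n),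
    noTower_split (fun T => SatelliteRecurrent T ∧ ¬ TauTwoHugging T n) GermHugging]
  simp only [and_assoc]

/-- The τ≥2-hugging leaf in its natural (un-intersected) form suffices. [folklore] -/
theorem srtt_of_leaves {n : ℕ} (h2 : TauTwoHuggingTowersTerminate n) (hG : GermHuggingTowersTerminate n)
    (hV : ValuativeTowersTerminate n) : SatelliteRecurrentTowersTerminate n :=
  srtt_iff_leaves.mpr ⟨noTower_mono (fun _ h => h.2) h2, hG, hV⟩

/-- Every leaf is implied by the tower piece (so each is WEAKER-or-equal by construction). [folklore] -/
theorem leaves_of_ftt {n : ℕ} (h : ForcedTowersTerminate n) :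
    EventuallyFreeTowersTerminate n ∧ SatelliteRecurrentTowersTerminate n ∧ TauTwoHuggingTowersTerminate n ∧
      GermHuggingTowersTerminate n ∧ ValuativeTowersTerminate n := by
  have h' := forcedTowersTerminate_iff_noTower.mp h
  exact ⟨noTower_mono (fun _ _ => trivial) h', noTower_mono (fun _ _ => trivial) h',
    noTower_mono (fun _ _ => trivial) h', noTower_mono (fun _ _ => trivial) h', noTower_mono (fun _ _ => trivial) h'⟩

/-! ## §3 The new ports (typed TRUE-as-stated: the two differential ones over PERFECT ground fields only) -/

/-- «No infinite forced tower of the class OVER A PERFECT GROUND FIELD satisfies `P`» — the column in which the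
differential ports (M1)/(M3) are proved (for imperfect `k`, `V(Diff^{≤n-1}_{Y/k} I)` can exceed the top locus at
residually inseparable points: lens-5's FieldColumns territory, left UNDECIDED here). -/
def NoTowerPerfect (n : ℕ) (P : ForcedTower → Prop) : Prop :=
  ∀ p : ℕ, p.Prime → ∀ (k : Type) [Field k] [CharP k p] [PerfectField k] (T : ForcedTower)
    (g : T.St 0 ⟶ Spec (.of k)),
    IsBase (T.St 0) g → IsDatum n (T.D 0) → (T.D 0).boundary = [] → P T → False

/-- pure logic. [folklore] -/
theorem noTowerPerfect_of_noTower {n : ℕ} {P : ForcedTower → Prop} (h : NoTower n P) : NoTowerPerfect n P :=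
  fun p hp k _ _ _ T g hB hD hE hP => h p hp k T g hB hD hE hP

/-- pure logic. [folklore] -/
theorem noTowerPerfect_mono {n : ℕ} {P Q : ForcedTower → Prop} (hPQ : ∀ T, Q T → P T) (h : NoTowerPerfect n P) :
    NoTowerPerfect n Q :=
  fun p hp k _ _ _ T g hB hD hE hQ => h p hp k T g hB hD hE (hPQ T hQ)

/-- PORT `TowerDivergence` — NEW LEMMA (M1), complete paper proof in the module docstring (Giraud's char-free
inclusion `x_i^{-1} Diff^{≤n-1}(I_i) ⊆ Diff^{≤n-1}(I_{i+1})` + telescoping + `𝔪^N ⊆ Diff^{≤n-1}(I_0)_{pt 0}` by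
isolation, `Y` smooth over the PERFECT field `k` so that `V(Diff^{≤n-1} I) = {ord ≥ n}`): every infinite forced
tower of the class is DIVERGENT. -/
def TowerDivergence (n : ℕ) : Prop :=
  ∀ p : ℕ, p.Prime → ∀ (k : Type) [Field k] [CharP k p] [PerfectField k] (T : ForcedTower)
    (g : T.St 0 ⟶ Spec (.of k)),
    IsBase (T.St 0) g → IsDatum n (T.D 0) → (T.D 0).boundary = [] → Divergent T

/-- PORT `ProximityLaw` — COSTUME(cite) (M2) [CasasAlvero2000 Thm 3.5.3, §3.6; KiyekVicente2004 VII (7.1); in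
dimension d GranjaRodriguez2003, GranjaMartinezRodriguez2007]: `c_{i+1} = c_i + Σ_{older proximate j} c_j` (pure
blow-up bookkeeping, any field), so an unbounded `c` forces infinitely many satellite steps (w.r.t. the tower's own
components). -/
def ProximityLaw (n : ℕ) : Prop :=
  ∀ p : ℕ, p.Prime → ∀ (k : Type) [Field k] [CharP k p] (T : ForcedTower) (g : T.St 0 ⟶ Spec (.of k)),
    IsBase (T.St 0) g → IsDatum n (T.D 0) → (T.D 0).boundary = [] → Divergent T → SatelliteRecurrent T

/-- PORT `ConeLineLaw` — KNOWN-MOD-PORT (M3, first leaf) over PERFECT ground fields: a tower hugging a component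
`E_j` with `τ(pt j) ≥ 2` forever is the sequence of infinitely near points of the line `ℙ(Dir_j) ⊂ E_j` (cone
lemma), and order `n` at all of them puts that line into `supp (D (j+1))`, contradicting isolation of `pt (j+1)`
(equimultiplicity, HIO1988 §§20–23 / BGMW2011 3.2.2). -/
def ConeLineLaw (n : ℕ) : Prop :=
  NoTowerPerfect n fun T => TauTwoHugging T n

/-- PORT `ClassTwoTailsDie` — KNOWN-MOD-PORT (M4) [isolate `pt i` in an affine open `U` (`supp ∩ U = {pt i}`); `(U,
D i|_U)` is a datum of the class all of whose top points have class ≥ 2; `SeqDimFour 2 n` resolves it weakly; centre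
counting as in `TowerObstructs` (blow-ups are local on the base) forbids the infinite tail `pt i ← pt (i+1) ← ⋯`]. -/
def ClassTwoTailsDie (n : ℕ) : Prop :=
  SeqDimFour 2 n → ∀ p : ℕ, p.Prime → ∀ (k : Type) [Field k] [CharP k p] (T : ForcedTower)
    (g : T.St 0 ⟶ Spec (.of k)),
    IsBase (T.St 0) g → IsDatum n (T.D 0) → (T.D 0).boundary = [] → ClassTwoSomewhere T n k → False

/-! ## §4 Kernels: what the ports decide, and the located residuals at the `E 1` and RungOne levels -/

/-- (M1)+(M2) DECIDE the eventually-free towers over perfect ground fields (PROVED from the two ports). [folklore] -/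
theorem eventuallyFree_perfect_of_ports {n : ℕ} (hV : TowerDivergence n) (hL : ProximityLaw n) :
    NoTowerPerfect n EventuallyFreeOwn := by
  intro p hp k _ _ _ T g hB hD hE hF
  obtain ⟨i₀, hi₀⟩ := hF
  obtain ⟨i, hi, hs⟩ := hL p hp k T g hB hD hE (hV p hp k T g hB hD hE) i₀
  exact hi₀ i hi hs

/-- (M3, first leaf) over perfect ground fields IS the port `ConeLineLaw` (recorded for the census of what is
decided). [folklore] -/
theorem tauTwoHugging_perfect_of_coneLineLaw {n : ℕ} (hC : ConeLineLaw n) :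
    NoTowerPerfect n fun T => TauTwoHugging T n :=
  hC

/-- Hence over perfect ground fields the WHOLE tower piece reduces to the two open leaves (PROVED from the ports).
[folklore] -/
theorem forcedTowers_perfect_of_leaves {n : ℕ} (hV : TowerDivergence n) (hL : ProximityLaw n) (hC : ConeLineLaw n)
    (hG : GermHuggingTowersTerminate n) (hW : ValuativeTowersTerminate n) : NoTowerPerfect n fun _ => True := by
  intro p hp k _ _ _ T g hB hD hE _
  by_cases hs : SatelliteRecurrent T
  · by_cases ht : TauTwoHugging T n
    · exact hC p hp k T g hB hD hE ht
    · by_cases hG' : GermHugging T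
      · exact hG p hp k T g hB hD hE ⟨hs, ht, hG'⟩
      · exact hW p hp k T g hB hD hE ⟨hs, ht, hG'⟩
  · exact eventuallyFree_perfect_of_ports hV hL p hp k T g hB hD hE
      (eventuallyFree_of_not_satelliteRecurrent hs)

/-- LOCATED RESIDUAL at the level of the target (all ground fields):
`WOR n ⟸ g7-ports ∧ EventuallyFreeTT ∧ TauTwoHuggingTT ∧ GermHuggingTT ∧ ValuativeTT ∧ NonIsolatedReduction`
(the first two tower leaves DECIDED over perfect `k` by `eventuallyFree_perfect_of_ports` / `ConeLineLaw`).
[folklore] -/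
theorem wor_of_located {n : ℕ} (hS : ForcedSeed n) (hD : ForcedDescent n) (hF : EventuallyFreeTowersTerminate n)
    (h2 : TauTwoHuggingTowersTerminate n) (hG : GermHuggingTowersTerminate n) (hW : ValuativeTowersTerminate n)
    (hN : NonIsolatedReduction n) : WOR n :=
  wor_of_forced hS hD (ftt_iff_free_satellite.mpr ⟨hF, srtt_of_leaves h2 hG hW⟩) hN

/-- … and conversely every leaf is NECESSARY (mod the counting port): the cut is EXACT modulo ports. [folklore] -/
theorem located_of_wor {n : ℕ} (hT : TowerObstructs n) (h : WOR n) :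
    EventuallyFreeTowersTerminate n ∧ SatelliteRecurrentTowersTerminate n ∧ TauTwoHuggingTowersTerminate n ∧
      GermHuggingTowersTerminate n ∧ ValuativeTowersTerminate n ∧ NonIsolatedReduction n :=
  have hF := leaves_of_ftt (forcedTowersTerminate_of_wor hT h)
  ⟨hF.1, hF.2.1, hF.2.2.1, hF.2.2.2.1, hF.2.2.2.2, nonIsolatedReduction_of_wor h⟩

/-- CORE LEAF · UNDECIDED · ATTACKABLE: no infinite CORE (no stage of class ≥ 2) satellite-recurrent tower hugging a
proper germ. -/
def CoreGermHuggingTowersTerminate (n : ℕ) : Prop :=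
  ∀ p : ℕ, p.Prime → ∀ (k : Type) [Field k] [CharP k p] (T : ForcedTower) (g : T.St 0 ⟶ Spec (.of k)),
    IsBase (T.St 0) g → IsDatum n (T.D 0) → (T.D 0).boundary = [] → ¬ ClassTwoSomewhere T n k →
      SatelliteRecurrent T → GermHugging T → False

/-- CORE LEAF · IDEA-NEEDED (THE located residual of 29273 on the tower side): no infinite CORE VALUATIVE tower. -/
def CoreValuativeTowersTerminate (n : ℕ) : Prop :=
  ∀ p : ℕ, p.Prime → ∀ (k : Type) [Field k] [CharP k p] (T : ForcedTower) (g : T.St 0 ⟶ Spec (.of k)),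
    IsBase (T.St 0) g → IsDatum n (T.D 0) → (T.D 0).boundary = [] → ¬ ClassTwoSomewhere T n k →
      SatelliteRecurrent T → ¬ GermHugging T → False

/-- The two core leaves are implied by the corresponding `E 1`-level leaves (WEAKER-or-equal by construction).
[folklore] -/
theorem coreLeaves_of_leaves {n : ℕ} (h2 : TauTwoHuggingTowersTerminate n) (hG : GermHuggingTowersTerminate n)
    (hW : ValuativeTowersTerminate n) :
    CoreGermHuggingTowersTerminate n ∧ CoreValuativeTowersTerminate n := by
  refine ⟨fun p hp k _ _ T g hB hD hE _ hs hG' => ?_, fun p hp k _ _ T g hB hD hE _ hs hG' => ?_⟩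
  · by_cases ht : TauTwoHugging T n
    · exact h2 p hp k T g hB hD hE ht
    · exact hG p hp k T g hB hD hE ⟨hs, ht, hG'⟩
  · by_cases ht : TauTwoHugging T n
    · exact h2 p hp k T g hB hD hE ht
    · exact hW p hp k T g hB hD hE ⟨hs, ht, hG'⟩

/-- (M4): under `SeqDimFour 2 n` the tower piece reduces to the eventually-free leaf and the two CORE leaves (PROVED;
the τ≥2-hugging leaf is ABSORBED by `E 2`). [folklore] -/
theorem ftt_of_coreLeaves {n : ℕ} (hE2 : SeqDimFour 2 n) (hP : ClassTwoTailsDie n)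
    (hF : EventuallyFreeTowersTerminate n)
    (hG : CoreGermHuggingTowersTerminate n) (hW : CoreValuativeTowersTerminate n) : ForcedTowersTerminate n := by
  intro p hp k _ _ T g hB hD hE
  by_cases h2 : ClassTwoSomewhere T n k
  · exact hP hE2 p hp k T g hB hD hE h2
  by_cases hs : SatelliteRecurrent T
  · by_cases hG' : GermHugging T
    · exact hG p hp k T g hB hD hE h2 hs hG'
    · exact hW p hp k T g hB hD hE h2 hs hG'
  · exact hF p hp k T g hB hD hE (eventuallyFree_of_not_satelliteRecurrent hs)

/-- Over perfect ground fields, under `SeqDimFour 2 n`, ONLY the two core leaves remain (PROVED from the ports).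
[folklore] -/
theorem forcedTowers_perfect_of_coreLeaves {n : ℕ} (hE2 : SeqDimFour 2 n) (hP : ClassTwoTailsDie n)
    (hV : TowerDivergence n) (hL : ProximityLaw n) (hG : CoreGermHuggingTowersTerminate n)
    (hW : CoreValuativeTowersTerminate n) : NoTowerPerfect n fun _ => True := by
  intro p hp k _ _ _ T g hB hD hE _
  by_cases h2 : ClassTwoSomewhere T n k
  · exact hP hE2 p hp k T g hB hD hE h2
  by_cases hs : SatelliteRecurrent T
  · by_cases hG' : GermHugging T
    · exact hG p hp k T g hB hD hE h2 hs hG'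
    · exact hW p hp k T g hB hD hE h2 hs hG'
  · exact eventuallyFree_perfect_of_ports hV hL p hp k T g hB hD hE
      (eventuallyFree_of_not_satelliteRecurrent hs)

/-- Conversely the core leaves, the eventually-free leaf and the `E 2`-conditional nowhere-isolated piece are
NECESSARY for RungOne modulo the counting port and `E 2` itself (every refinement of 29273 loses exactly the
hypothesis `E 2`). [folklore] -/
theorem coreLeaves_of_e_one (hT : ∀ n, 1 ≤ n → TowerObstructs n) (h : E 1) :
    ∀ n, 1 ≤ n → EventuallyFreeTowersTerminate n ∧ CoreGermHuggingTowersTerminate n ∧ CoreValuativeTowersTerminate n ∧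
      NonIsolatedReduction n := by
  intro n hn
  have hw : WOR n := wor_of_seqDimFour_one (h n hn)
  have hL := located_of_wor (hT n hn) hw
  have hC := coreLeaves_of_leaves hL.2.2.1 hL.2.2.2.1 hL.2.2.2.2.1
  exact ⟨hL.1, hC.1, hC.2, hL.2.2.2.2.2⟩

end Summit.ResolutionOfSingularities.ResolutionOfSingularities.Theorems.DivergentTowerClasses
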